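import Summits.BirchSwinnertonDyer.BirchSwinnertonDyer.Theorems.PrintX9KatoEulerHalfRecord
import Literature.NumberTheory.EllipticCurves.Kato2004.DivisibilityInputsZetaLine
import HarnessLib

/-!
# p3's Kato-road headlines RE-KEYED from F1 to ty1's print-verbatim restatement F1′
# (`Kato2004.exists_divisibilityInputsZetaLine_fineQuotient_zeta`): the `μ`-transfer node, Kato's
# Thm. 17.4 at the pair, `μ = 0` from one unit coefficient, and the three per-pair doors D1/D2/D3 (X9,
# class-free `IrrOrd` form) and the two X10b doors at `p = 3` (print cell `bsd-print-x9`, seat p3 g2;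
# theorems only, nothing booked)

WHY. The F1 package `Kato2004.exists_divisibilityInputs_fineQuotient_zeta` carries, besides the
construction-fact token `KATO04-F1-package@p`, the registry flag `Kato04-p280-image_zeta_localized@Irr-only@p`
on its DERIVED field `image_zeta_localized`. The literature seat restated the package as F1′ =
`exists_divisibilityInputsZetaLine_fineQuotient_zeta` (`Kato2004/DivisibilityInputsZetaLine.lean`,
p539168): the derived field is REPLACED by two print-verbatim integral shadows ((F1a) `exists_zetaLine`,
Thm. 12.6 + 16.6 (2) + 17.5; (F1b) `col_loc_mem_span`, Prop. 17.11 + §17.13) and RE-PROVED from them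
(`DivisibilityInputsZetaLine.image_zeta_localized`, pure `Λ`-algebra — the kernel form is this seat's
`ZetaImage.imageLocalized_of_zetaLine`, p535554), with the porting term
`exists_divisibilityInputs_fineQuotient_zeta_of_zetaLine : F1′ → F1`. The cell referee recorded
(REF-AUDIT REF-34 (a)): «flag `Kato04-p280-image_zeta_localized@Irr-only@p` becomes DISCHARGEABLE for
every consumer that ports from F1 to F1′ via `…_of_zetaLine`; p3's doors still bind `hfine` = old F1».
This file does exactly that port for the consumers that matter to the two leaves, so that every
per-pair closure of this seat and the `μ`-transfer node can be cited with binder F1′ (one registry token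
left: the construction fact itself; currency word LITERAL unchanged — RUL-2/RUL-3):

* `katoMuTransfer_of_zetaLine : F1′ → Rank1Residual.KatoMuTransfer` (the K6 node = route PrintX9's item
  `MuTransfer` 19629 by name; same proof as K6's `smallImageMuTransfer_katoMuTransfer_of_fine`, route-free);
* `IrrOrd.kato_divisibility_of_zetaLine` (Kato Thm. 17.4 at the pair), `IrrOrd.mu_eq_zero_of_zetaLine_of_unitCoeff`
  (`μ = 0` from one unit coefficient, any irreducible image, `p ≥ 5`);
* doors `IrrOrd.bsdp_of_zetaLine_of_unitCoeff_of_shaAn_unit` (D1), `IrrOrd.bsdp_of_zetaLine_of_norm_constantCoeff_eq_one`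
  (D2), `IrrOrd.bsdp_rankOne_of_zetaLine_of_norm_coeff_one_eq_one` (D3) — binders byte-identical to the
  F1 forms of `PrintX9KatoEulerHalfRecord.lean` except `hfine ↦ hzeta`;
* X10b at `p = 3`: `X10b.bsdp_of_zetaLine_of_norm_constantCoeff_eq_one`,
  `X10b.bsdp_rankOne_of_zetaLine_of_norm_coeff_one_eq_one` (F1 forms in `PrintX10bKatoLambdaMatch.lean`).

Each proof is the F1 theorem fed `exists_divisibilityInputs_fineQuotient_zeta_of_zetaLine hzeta`. No new
fact, no statement change, no class theorem; currency PER PAIR, LITERAL (F1′). beyond-print theorem: no.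

References: [Kato2004Asterisque] Thm. 12.4–12.6 (pp. 221–222), 16.6 (p. 271), 17.4 (2) (p. 273),
17.5, Prop. 17.11 (p. 277), §17.13 (pp. 279–280); [GreenbergVatsal2000] Prop. 3.7; cell files
HOME/REF-AUDIT.md REF-34 (a), RUL-2/RUL-3, HOME/p3/F1-IMAGE-ZETA-AT-P.md.
-/

set_option linter.dupNamespace false
set_option autoImplicit false

noncomputable section

open scoped Classical MatrixGroups ModularForm

open CongruenceSubgroup WeierstrassCurve Literature.NumberTheory.EllipticCurves
  Literature.NumberTheory.EllipticCurves.ModularForms Literature.NumberTheory.EllipticCurves.Rank1Residual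
  Literature.NumberTheory.EllipticCurves.Rank1Residual.Typed
  Literature.NumberTheory.EllipticCurves.Wuthrich2014
  Literature.NumberTheory.EllipticCurves.Kato2004
  Summit.BirchSwinnertonDyer.BirchSwinnertonDyer.Theorems.Rank1ResidualX1Defs
  Summit.BirchSwinnertonDyer.Rank1Residual

namespace Summit.BirchSwinnertonDyer.BirchSwinnertonDyer.Rank1Residual

variable (W : WeierstrassCurve ℚ) [W.IsElliptic] [W.IsGloballyMinimal] (p : ℕ) [Fact p.Prime]

/-! ### §1. The node and the two engines, keyed on F1′ -/

/-- **F1′ ⟹ the `μ`-transfer node `Rank1Residual.KatoMuTransfer`** (route PrintX9's item `MuTransfer` =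
K6 item 19629 BY NAME), ROUTE-FREE: the proof of the K6 kernel `smallImageMuTransfer_katoMuTransfer_of_fine`
(surjective case: Kato 17.4 (3) from the package + principal characteristic ideal; non-surjective case, CM or
not: the X10/X9 core `X10.mu_eq_zero_of_fine`) replayed on F1 := the porting term applied to F1′ (no
import of the K6 route cone). The node stays OPEN (F1′ is a construction fact, taken as hypothesis), with the
`image_zeta_localized` registry token dischargeable on this form.
[cite: Kato2004Asterisque, Thm. 12.5, 12.6 (p. 222), Thm. 17.4 (p. 273), §17.13 (pp. 279–280)]
[cite: GreenbergVatsal2000, Prop. 3.7] -/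
theorem katoMuTransfer_of_zetaLine (hzeta : exists_divisibilityInputsZetaLine_fineQuotient_zeta) :
    KatoMuTransfer := by
  have hfine := exists_divisibilityInputs_fineQuotient_zeta_of_zetaLine hzeta
  intro W _ _ p _ N _ f hp hgood hap hirr hf hcert κ γ hκ hγ hγ' D
  have hp2 : p ≠ 2 := by omega
  by_cases hsurj : W.HasSurjectiveModNGaloisRep p
  · -- surjective image: Kato 17.4 (3) from F1, the characteristic ideal is principal, `μ` drops
    haveI : Module.Finite (IwasawaAlgebra p) D.X := D.module_finite_holds hγ
    obtain ⟨hX, -, h3⟩ := Summit.BirchSwinnertonDyer.Rank1Residual.X10.kato_divisibility_of_fine hfine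
      W p κ γ N f hp2 ⟨hgood, hap⟩ hκ hγ hγ' hf D
    obtain ⟨g₁, hg₁, hιg₁⟩ := h3 (hasSurjectiveModNGaloisRep_pow_of_surj hp hsurj)
    obtain ⟨g₀, hg₀⟩ := (charIdeal_isPrincipal_holds p D.X).principal
    have hchar : D.charIdeal = Ideal.span {g₀} := hg₀
    have hg₁u : GreenbergVatsal2000.HasUnitContent g₁ := hasUnitContent_of_map_eq g₁ _ hιg₁ hcert
    have hg₀u : GreenbergVatsal2000.HasUnitContent g₀ :=
      hasUnitContent_of_mem_span_singleton (hchar ▸ hg₁) hg₁u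
    exact (GreenbergVatsal2000.mu_eq_zero_iff_hasUnitContent D hX hchar).mpr hg₀u
  · -- non-surjective image (CM or not): the X10/X9 core of the cell's Theorem A
    exact Summit.BirchSwinnertonDyer.Rank1Residual.X10.mu_eq_zero_of_fine hfine W p f hp2 hgood hap hirr
      hsurj hf hcert κ γ hκ hγ hγ' D

/-- **F1′ ⟹ Kato's Thm. 17.4 at the pair** (tree shape `kato_divisibility`: torsion, clause (2)
`p^n L_p ∈ ι(char_Λ X)`, clause (3) under surjectivity), for every elliptic `W`, odd good ordinary `p`,
cyclotomic datum and level-`N` newform — `X10.kato_divisibility_of_fine` re-keyed.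
[cite: Kato2004Asterisque, Thm. 17.4 (p. 273) and §17.13 (pp. 279–280)] -/
theorem IrrOrd.kato_divisibility_of_zetaLine (hzeta : exists_divisibilityInputsZetaLine_fineQuotient_zeta)
    (κ : ZpExtension ℚ p) (γ : Field.absoluteGaloisGroup ℚ) (N : ℕ) [NeZero N]
    (f : CuspForm (Gamma0 N) 2) : kato_divisibility W p (κ := κ) (γ := γ) (f := f) :=
  Summit.BirchSwinnertonDyer.Rank1Residual.X10.kato_divisibility_of_fine
    (exists_divisibilityInputs_fineQuotient_zeta_of_zetaLine hzeta) W p κ γ N f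

/-- **F1′ + one unit coefficient ⟹ `μ(X(E/ℚ_∞)) = 0`**, `p ≥ 5` good ordinary, `E[p]` irreducible, ANY
image (surjective: Kato 17.4 (3); non-surjective: the X10/X9 core) — `IrrOrd.mu_eq_zero_of_fine_of_unitCoeff`
re-keyed. [cite: Kato2004Asterisque, Thm. 12.5 (4), 12.6 (p. 222), Thm. 17.4 (3) (p. 273) and §17.13 (pp. 279–280)]
[cite: GreenbergVatsal2000, p. 2, (1)–(2)] -/
theorem IrrOrd.mu_eq_zero_of_zetaLine_of_unitCoeff
    (hzeta : exists_divisibilityInputsZetaLine_fineQuotient_zeta)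
    (hmodP : nonempty_modularParametrizationData) (hp : 5 ≤ p)
    (hgood : W.HasGoodReductionAtPrime p) (hord : ¬ (p : ℤ) ∣ W.frobeniusTrace p)
    (hirr : W.HasIrreducibleModPGaloisRep p)
    (hcert : ∀ [NeZero (W.conductorNorm ℤ)] (f : CuspForm (Gamma0 (W.conductorNorm ℤ)) 2),
      IsNewformOf W f → ∃ n : ℕ, ‖PowerSeries.coeff n (padicLFunction f (unitRoot W p : ℚ_[p]))‖ = 1) :
    ∀ (κ : ZpExtension ℚ p) (γ : Field.absoluteGaloisGroup ℚ),
      κ.IsCyclotomic → κ.IsTopGenerator γ → IsCyclotomicVariable p γ →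
      ∀ D : W.SelmerDualData κ γ, D.mu = 0 :=
  IrrOrd.mu_eq_zero_of_fine_of_unitCoeff W p (exists_divisibilityInputs_fineQuotient_zeta_of_zetaLine hzeta)
    hmodP hp hgood hord hirr hcert

/-! ### §2. The three X9-side doors (class-free `IrrOrd` form), keyed on F1′ -/

/-- **Door D1 on F1′**: `p ≥ 5` good ordinary, `E[p]` irreducible (any image), `r_an ≤ 1`,
`p ∤ #Ш(E/ℚ)_an`, one unit coefficient, the Schneider certificate at `r_an = 1` ⟹ `BSD(E,p)` —
`IrrOrd.bsdp_of_fine_of_unitCoeff_of_shaAn_unit` re-keyed (binders otherwise byte-identical).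
[cite: Kato2004Asterisque, Thm. 17.4 (2) (p. 273)] [cite: GreenbergLNM1716, Thm. 4.1 (p. 102)]
[cite: PerrinRiou1987, §1.4 Cor. 1.8] [cite: Miller2011LMS, Def. 1.1 (arXiv:1010.2431 p. 3)] -/
theorem IrrOrd.bsdp_of_zetaLine_of_unitCoeff_of_shaAn_unit
    (hzeta : exists_divisibilityInputsZetaLine_fineQuotient_zeta) (hGr : greenberg_charValue_rankZero)
    (hS : Schneider1985_order_charGenerator_odd) (hPR : perrinRiou_rankOne_leadingTerms_odd)
    (hmodP : nonempty_modularParametrizationData) (hmodL : hasEntireLFunction_rat)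
    (hGZK : rank_eq_analyticRank_of_analyticRank_le_one) (h5 : realPeriodRat_eq_unit_mul_plusPeriod)
    (hp : 5 ≤ p) (hgood : W.HasGoodReductionAtPrime p) (hord : ¬ (p : ℤ) ∣ W.frobeniusTrace p)
    (hirr : W.HasIrreducibleModPGaloisRep p) (hr : W.analyticRank ≤ 1)
    (hSch : W.analyticRank = 1 → ∀ Dh : PAdicHeightData W p, Dh.IsCanonical → SchneiderConjecture Dh)
    (hcertA : ∀ {N : ℕ} [NeZero N] (f : CuspForm (Gamma0 N) 2), IsNewformOf W f →
      ∃ n : ℕ, ‖PowerSeries.coeff n (padicLFunction f (unitRoot W p : ℚ_[p]))‖ = 1)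
    (hunit : ∃ q : ℚ, shaAn W = (q : ℂ) ∧ padicValRat p q = 0) : BSDp W p :=
  IrrOrd.bsdp_of_fine_of_unitCoeff_of_shaAn_unit W p
    (exists_divisibilityInputs_fineQuotient_zeta_of_zetaLine hzeta) hGr hS hPR hmodP hmodL hGZK h5 hp hgood
    hord hirr hr hSch hcertA hunit

/-- **Door D2 on F1′** (rank-0 unit cell): `p ≥ 5` good ordinary, `E[p]` irreducible (any image), ONE
datum `‖L_p(f,α)(0)‖ = 1` ⟹ `BSD(E,p)` — `IrrOrd.bsdp_of_fine_of_norm_constantCoeff_eq_one` re-keyed.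
[cite: Kato2004Asterisque, Thm. 17.4 (2) (p. 273)] [cite: GreenbergVatsal2000, Prop. 3.7 and p. 20]
[cite: GreenbergLNM1716, Thm. 4.1 (p. 102)] [cite: Miller2011LMS, Def. 1.1 (arXiv:1010.2431 p. 3)] -/
theorem IrrOrd.bsdp_of_zetaLine_of_norm_constantCoeff_eq_one
    (hzeta : exists_divisibilityInputsZetaLine_fineQuotient_zeta) (hGr : greenberg_charValue_rankZero)
    (hmodP : nonempty_modularParametrizationData) (hGZK : rank_eq_analyticRank_of_analyticRank_le_one)
    (h5 : realPeriodRat_eq_unit_mul_plusPeriod) (hp : 5 ≤ p) (hgood : W.HasGoodReductionAtPrime p)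
    (hord : ¬ (p : ℤ) ∣ W.frobeniusTrace p) (hirr : W.HasIrreducibleModPGaloisRep p)
    (hcert0 : ∀ [NeZero (W.conductorNorm ℤ)] (f : CuspForm (Gamma0 (W.conductorNorm ℤ)) 2),
      IsNewformOf W f → ‖PowerSeries.coeff 0 (padicLFunction f (unitRoot W p : ℚ_[p]))‖ = 1) :
    BSDp W p :=
  IrrOrd.bsdp_of_fine_of_norm_constantCoeff_eq_one W p
    (exists_divisibilityInputs_fineQuotient_zeta_of_zetaLine hzeta) hGr hmodP hGZK h5 hp hgood hord hirr
    hcert0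

/-- **Door D3 on F1′** (rank-1 cell): `p ≥ 5` good ordinary, `E[p]` irreducible (any image),
`r_an = 1`, ONE datum `‖[T¹]L_p(f,α)‖ = 1` ⟹ `BSD(E,p)` (the coefficient is the `μ`-certificate, the
`λ`-match and the Schneider certificate) — `IrrOrd.bsdp_rankOne_of_fine_of_norm_coeff_one_eq_one` re-keyed.
[cite: Kato2004Asterisque, Thm. 17.4 (2) (p. 273)] [cite: PerrinRiou1987, §1.4 Cor. 1.8]
[cite: BalakrishnanMullerStein2015, Thm. 1.7] [cite: Miller2011LMS, Def. 1.1 (arXiv:1010.2431 p. 3)] -/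
theorem IrrOrd.bsdp_rankOne_of_zetaLine_of_norm_coeff_one_eq_one
    (hzeta : exists_divisibilityInputsZetaLine_fineQuotient_zeta)
    (hS : Schneider1985_order_charGenerator_odd) (hPR : perrinRiou_rankOne_leadingTerms_odd)
    (hmodP : nonempty_modularParametrizationData) (hGZK : rank_eq_analyticRank_of_analyticRank_le_one)
    (h5 : realPeriodRat_eq_unit_mul_plusPeriod) (hp : 5 ≤ p) (hgood : W.HasGoodReductionAtPrime p)
    (hord : ¬ (p : ℤ) ∣ W.frobeniusTrace p) (hirr : W.HasIrreducibleModPGaloisRep p)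
    (hr1 : W.analyticRank = 1)
    (hcert1 : ∀ [NeZero (W.conductorNorm ℤ)] (f : CuspForm (Gamma0 (W.conductorNorm ℤ)) 2),
      IsNewformOf W f → ‖PowerSeries.coeff 1 (padicLFunction f (unitRoot W p : ℚ_[p]))‖ = 1) :
    BSDp W p :=
  IrrOrd.bsdp_rankOne_of_fine_of_norm_coeff_one_eq_one W p
    (exists_divisibilityInputs_fineQuotient_zeta_of_zetaLine hzeta) hS hPR hmodP hGZK h5 hp hgood hord
    hirr hr1 hcert1

/-! ### §3. The two X10b doors at `p = 3`, keyed on F1′ -/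

/-- **X10b door at `p = 3`, rank-0 unit cell, on F1′**: class X10 with `ρ̄_{E,3}` not onto, ONE datum
`‖L_3(f,α)(0)‖ = 1` ⟹ `BSD(E,3)` — `X10b.bsdp_of_fine_of_norm_constantCoeff_eq_one` re-keyed.
[cite: Kato2004Asterisque, Thm. 17.4 (2) (p. 273)] [cite: GreenbergVatsal2000, Prop. 3.7 and p. 20]
[cite: GreenbergLNM1716, Thm. 4.1 (p. 102)] -/
theorem X10b.bsdp_of_zetaLine_of_norm_constantCoeff_eq_one
    (hzeta : exists_divisibilityInputsZetaLine_fineQuotient_zeta) (hGr : greenberg_charValue_rankZero)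
    (hmodP : nonempty_modularParametrizationData) (hGZK : rank_eq_analyticRank_of_analyticRank_le_one)
    (h3 : realPeriodRat_eq_unit_mul_plusPeriod_three) (hX : ClassX10 W p) (hns : ¬ Surj W 3)
    (hcert0 : ∀ [NeZero (W.conductorNorm ℤ)] (f : CuspForm (Gamma0 (W.conductorNorm ℤ)) 2),
      IsNewformOf W f → ‖PowerSeries.coeff 0 (padicLFunction f (unitRoot W p : ℚ_[p]))‖ = 1) :
    BSDp W p :=
  X10b.bsdp_of_fine_of_norm_constantCoeff_eq_one W p
    (exists_divisibilityInputs_fineQuotient_zeta_of_zetaLine hzeta) hGr hmodP hGZK h3 hX hns hcert0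

/-- **X10b door at `p = 3`, rank-1 cell, on F1′**: class X10 with `ρ̄_{E,3}` not onto, `r_an = 1`,
ONE datum `‖[T¹]L_3(f,α)‖ = 1` ⟹ `BSD(E,3)` — `X10b.bsdp_rankOne_of_fine_of_norm_coeff_one_eq_one`
re-keyed. [cite: Kato2004Asterisque, Thm. 17.4 (2) (p. 273)] [cite: PerrinRiou1987, §1.4 Cor. 1.8]
[cite: BalakrishnanMullerStein2015, Thm. 1.7] -/
theorem X10b.bsdp_rankOne_of_zetaLine_of_norm_coeff_one_eq_one
    (hzeta : exists_divisibilityInputsZetaLine_fineQuotient_zeta)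
    (hS : Schneider1985_order_charGenerator_odd) (hPR : perrinRiou_rankOne_leadingTerms_odd)
    (hmodP : nonempty_modularParametrizationData) (hGZK : rank_eq_analyticRank_of_analyticRank_le_one)
    (h3 : realPeriodRat_eq_unit_mul_plusPeriod_three) (hX : ClassX10 W p) (hns : ¬ Surj W 3)
    (hr1 : W.analyticRank = 1)
    (hcert1 : ∀ [NeZero (W.conductorNorm ℤ)] (f : CuspForm (Gamma0 (W.conductorNorm ℤ)) 2),
      IsNewformOf W f → ‖PowerSeries.coeff 1 (padicLFunction f (unitRoot W p : ℚ_[p]))‖ = 1) :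
    BSDp W p :=
  X10b.bsdp_rankOne_of_fine_of_norm_coeff_one_eq_one W p
    (exists_divisibilityInputs_fineQuotient_zeta_of_zetaLine hzeta) hS hPR hmodP hGZK h3 hX hns hr1 hcert1

end Summit.BirchSwinnertonDyer.BirchSwinnertonDyer.Rank1Residual

end
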